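import Mathlib
import HarnessLib.Audit
import Summits.PneNP.PneNP.Theorems.PstarGraphQuadGapTwoCases

/-!
# Two quadratic forms over a family of fibres: the edge bound without same-fibre edge-minimality (ROUND-24, GAPTWO-PLAN S3 with a core)

FRONTIER range-avoidance ladder, rung F-N3, ROUND 24 (cell `pnp-ideate`, planner memo `r24/GAPTWO-PLAN.md` v0 §3/§4 S3; restricted-model
proof complexity — nothing here bears on `P` versus `NP`).

`PstarGraphQuadGapTwoCases.two_forms_bound` (T24.11c) bounds the edges of two quadratic functions `f_i = qform T_i + L_i + c_i` on ONE
coset `b₀ + D` on which they are never simultaneously `0` and on which every edge has its edge-minimality witness.  In the `|W| = 2`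
analysis WITH A CORE (terminal form of the memo: core `J₀`, two G-constraints `Γ₁, Γ₂` carrying the folded outputs as monomials) the
natural cosets are the FIBRES over the solutions of the core — all assignments agreeing with a core solution outside the set `U` of
"free" AND variables (read by no core output): on every fibre the two constraints are quadratic functions of the free variables with the
SAME quadratic parts `T₁, T₂` (the folded outputs with both AND variables free) and fibre-dependent affine parts, never simultaneously
satisfied; but the flip witness of a folded output ((M′) of the terminal form) lives on ITS OWN fibre.

**`two_forms_fibres`.**  Let `T₁, T₂ ⊆ E`, `E` a simple graph of maximum degree `Δ` on `V` vertices, and for every index `ζ` of a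
family let `f_i ζ = qform T_i + L_i ζ + c_i ζ` (`i = 1,2`) be never simultaneously `0` on `𝔽₂^V`; suppose every edge `j ∈ E` has a
witness `(ζ, x)` with `f_i ζ x = 0 ↔ j ∉ T_i`.  Then **`|E| ≤ 6Δ²`**.  Proof: the Lagrangian packages `n₁, n₂, n₁₂` of
`T₁, T₂, T₁ △ T₂` against `D = ⊤` (`PstarGraphQuadGapTwoForms.form_package`) do not depend on the fibre; the unsat identity on any one
fibre gives `2^V ≤ 2^{n₁} + 2^{n₂} + 2^{n₁₂}`, so (`pow_three_cases`) either two of the three forms have `n + n' ≥ 2V − 3` and cover `E`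
(`|E| ≤ 6Δ²`), or one form has `⊤`-isotropic polar form, i.e. is EMPTY as an edge set (`eq_empty_of_iso_top`); then the argument moves
to the witness fibre of one remaining edge, where the affine dichotomy / constancy (`affine_dichotomy`, `const_iso`) and a two-term
recount finish exactly as in T24.11c (`bound_of_iso_fst`, `bound_of_iso_symmDiff`).  The application to the terminal form (fibre
transport) is the sequel `PstarFreeFolded`.
-/

set_option linter.dupNamespace false -- `Summit.PneNP.PneNP.…`: summit = sub-problem name (D-0017 single-conjunct layout)

open Finset Module
open scoped symmDiff
open Summit.PneNP.PneNP.Theorems.PstarProductRank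
open Summit.PneNP.PneNP.Theorems.PstarGraphQuadGap
open Summit.PneNP.PneNP.Theorems.PstarQuadBias
open Summit.PneNP.PneNP.Theorems.PstarGraphQuadGapTwoForms

namespace Summit.PneNP.PneNP.Theorems.PstarFreeFoldedForms

/-- A non-zero element of `𝔽₂` is `1`. -/
private theorem zmod2_eq_one_of_ne_zero {x : ZMod 2} (h : x ≠ 0) : x = 1 := by
  revert x h; decide

/-- In `𝔽₂`, `a + b = 0` means `a = b`. -/
private theorem zmod2_eq_of_add_eq_zero {a b : ZMod 2} (h : a + b = 0) : a = b := by
  revert a b h; decide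

variable {V : ℕ}

/-- The whole space has dimension `V`. -/
theorem finrank_top_fun : finrank (ZMod 2) (⊤ : Submodule (ZMod 2) (Fin V → ZMod 2)) = V := by
  simp

/-- The whole space, as a finset, is `univ`. -/
theorem mem_univ_iff_top (x : Fin V → ZMod 2) : x ∈ (univ : Finset (Fin V → ZMod 2)) ↔ x ∈ (⊤ : Submodule (ZMod 2) (Fin V → ZMod 2)) := by
  simp

/-- `|univ| = 2^V`. -/
theorem card_univ_fun : ((univ : Finset (Fin V → ZMod 2)).card : ℤ) = 2 ^ V := by
  have h := card_eq_two_pow_finrank (⊤ : Submodule (ZMod 2) (Fin V → ZMod 2)) univ mem_univ_iff_top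
  rw [finrank_top_fun] at h
  exact_mod_cast h

/-- **A sub-form whose polar form vanishes identically is empty** (simple graph: the polar form of an edge `(p,q)` pairs `e_p` with
`e_q` to `1`; packaged through the landed count `|T| ≤ 2Δ²(V − dim N)` at `N = ⊤`). -/
theorem eq_empty_of_iso_top {E T : Finset (Edge V)} {Δ : ℕ} (hS : Simple E) (hΔ : EdgeMaxDegree Δ E) (hTE : T ⊆ E)
    (hiso : ∀ u ∈ (⊤ : Submodule (ZMod 2) (Fin V → ZMod 2)), ∀ v ∈ (⊤ : Submodule (ZMod 2) (Fin V → ZMod 2)),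
      polar T Prod.fst Prod.snd u v = 0) : T = ∅ := by
  have h := card_le_of_isotropic_sub Δ hS hΔ hTE hiso
  rw [finrank_top_fun, Nat.sub_self, mul_zero] at h
  exact card_eq_zero.1 (Nat.le_zero.1 h)

section Fibres

variable {E T₁ T₂ : Finset (Edge V)} {Δ : ℕ} {Z : Type*}
  {f₁ f₂ : Z → (Fin V → ZMod 2) → ZMod 2} {L₁ L₂ : Z → (Fin V → ZMod 2) →ₗ[ZMod 2] ZMod 2} {c₁ c₂ : Z → ZMod 2}

/-- Coverage: the witness of an edge lies in an unsat fibre, so the edge is in `T₁ ∪ T₂`. -/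
theorem mem_or_mem_fibres (hunsat : ∀ ζ x, f₁ ζ x ≠ 0 ∨ f₂ ζ x ≠ 0)
    (hmin : ∀ j ∈ E, ∃ ζ x, (f₁ ζ x = 0 ↔ j ∉ T₁) ∧ (f₂ ζ x = 0 ↔ j ∉ T₂)) : ∀ j ∈ E, j ∈ T₁ ∨ j ∈ T₂ := by
  intro j hj
  obtain ⟨ζ, x, h1, h2⟩ := hmin j hj
  by_contra h
  push Not at h
  rcases hunsat ζ x with h' | h'
  · exact h' (h1.2 h.1)
  · exact h' (h2.2 h.2)

/-- **The isotropic case for `T₁`** (then `T₁ = ∅`): `|E| ≤ 2Δ²`, through the witness fibre of an edge of `T₂`. -/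
theorem bound_of_iso_fst (hS : Simple E) (hΔ : EdgeMaxDegree Δ E) (hT₁E : T₁ ⊆ E) (hT₂E : T₂ ⊆ E)
    (hf₁ : ∀ ζ x, f₁ ζ x = qform T₁ Prod.fst Prod.snd x + L₁ ζ x + c₁ ζ)
    (hf₂ : ∀ ζ x, f₂ ζ x = qform T₂ Prod.fst Prod.snd x + L₂ ζ x + c₂ ζ)
    (hunsat : ∀ ζ x, f₁ ζ x ≠ 0 ∨ f₂ ζ x ≠ 0)
    (hmin : ∀ j ∈ E, ∃ ζ x, (f₁ ζ x = 0 ↔ j ∉ T₁) ∧ (f₂ ζ x = 0 ↔ j ∉ T₂))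
    (hiso₁ : ∀ u ∈ (⊤ : Submodule (ZMod 2) (Fin V → ZMod 2)), ∀ v ∈ (⊤ : Submodule (ZMod 2) (Fin V → ZMod 2)),
      polar T₁ Prod.fst Prod.snd u v = 0) :
    E.card ≤ 2 * Δ ^ 2 := by
  classical
  set D : Submodule (ZMod 2) (Fin V → ZMod 2) := ⊤ with hDdef
  have h𝒟 : ∀ x, x ∈ (univ : Finset (Fin V → ZMod 2)) ↔ x ∈ D := mem_univ_iff_top
  have hdim : finrank (ZMod 2) D = V := finrank_top_fun
  have hT₁ : T₁ = ∅ := eq_empty_of_iso_top hS hΔ hT₁E hiso₁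
  have hcov := mem_or_mem_fibres hunsat hmin
  have hET₂ : E ⊆ T₂ := fun j hj => by
    rcases hcov j hj with h | h
    · rw [hT₁] at h; exact absurd h (notMem_empty j)
    · exact h
  rcases T₂.eq_empty_or_nonempty with hT₂ | ⟨j, hj⟩
  · rw [hT₂] at hET₂; rw [subset_empty.1 hET₂, card_empty]; exact Nat.zero_le _
  -- the witness fibre of `j ∈ T₂`: there `f₁ = 0` and `f₂ ≠ 0`
  obtain ⟨ζ, x, h1, h2⟩ := hmin j (hT₂E hj)
  have hx1 : f₁ ζ x = 0 := h1.2 (by rw [hT₁]; exact notMem_empty j)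
  have hq₁ : ∀ x w, f₁ ζ (x + w) = f₁ ζ x + f₁ ζ w - f₁ ζ 0 + polar T₁ Prod.fst Prod.snd x w := by
    intro x w; simp only [hf₁]; exact quadratic_of_qform T₁ Prod.fst Prod.snd (L₁ ζ) (c₁ ζ) x w
  have hq₂ : ∀ x w, f₂ ζ (x + w) = f₂ ζ x + f₂ ζ w - f₂ ζ 0 + polar T₂ Prod.fst Prod.snd x w := by
    intro x w; simp only [hf₂]; exact quadratic_of_qform T₂ Prod.fst Prod.snd (L₂ ζ) (c₂ ζ) x w
  obtain ⟨g₃, hg₃⟩ : ∃ g : (Fin V → ZMod 2) → ZMod 2, ∀ x, g x = f₁ ζ x + f₂ ζ x := ⟨_, fun _ => rfl⟩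
  have hq₃ : ∀ x w, g₃ (x + w) = g₃ x + g₃ w - g₃ 0 + polar (T₁ ∆ T₂) Prod.fst Prod.snd x w := by
    intro x w; simp only [hg₃]; rw [polar_symmDiff, hq₁, hq₂]; ring
  have hT₃E : T₁ ∆ T₂ ⊆ E := fun j hj => by
    rcases mem_symmDiff.1 hj with h | h
    exacts [hT₁E h.1, hT₂E h.1]
  rcases affine_dichotomy D univ h𝒟 (f₁ ζ) hq₁ x hiso₁ with hε₁ | hconst
  · -- bias of `f₁` vanishes on this fibre: two-term recount
    obtain ⟨n₂, hn₂d, hT₂c, hε₂, hiso₂⟩ := form_package Δ hS hΔ hT₂E D univ h𝒟 (f₂ ζ) hq₂ x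
    obtain ⟨n₃, hn₃d, hT₃c, hε₃, hiso₃⟩ := form_package Δ hS hΔ hT₃E D univ h𝒟 g₃ hq₃ x
    rw [hdim] at hn₂d hn₃d hiso₂ hiso₃
    have hcard := card_le_abs_add univ (fun u => f₁ ζ (x + u)) (fun u => f₂ ζ (x + u)) fun u _ => hunsat ζ (x + u)
    simp only [← hg₃] at hcard
    rw [hε₁, abs_zero, zero_add, card_univ_fun] at hcard
    have hpow : 2 ^ V ≤ 2 ^ n₂ + 2 ^ n₃ := by
      have : (2 : ℤ) ^ V ≤ 2 ^ n₂ + 2 ^ n₃ := by linarith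
      exact_mod_cast this
    rcases pow_two_cases hn₂d hn₃d hpow with h | h | ⟨h, -⟩
    · have hT₂ : T₂ = ∅ := eq_empty_of_iso_top hS hΔ hT₂E (hiso₂ h)
      rw [hT₂] at hj; exact absurd hj (notMem_empty j)
    · have hT₃ : T₁ ∆ T₂ = ∅ := eq_empty_of_iso_top hS hΔ hT₃E (hiso₃ h)
      rw [hT₁] at hT₃
      have hT₂ : T₂ = ∅ := by simpa using hT₃
      rw [hT₂] at hj; exact absurd hj (notMem_empty j)
    · have h1 : V - n₂ ≤ 1 := by omega
      calc E.card ≤ T₂.card := card_le_card hET₂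
        _ ≤ 2 * Δ ^ 2 * (V - n₂) := hT₂c
        _ ≤ 2 * Δ ^ 2 * 1 := Nat.mul_le_mul_left _ h1
        _ = 2 * Δ ^ 2 := mul_one _
  · -- `f₁` constant `= 0` on this fibre, so `f₂ ≡ 1` there: `T₂` isotropic, empty
    have hf₂one : ∀ u ∈ D, f₂ ζ (x + u) = 1 := by
      intro u hu
      rcases hunsat ζ (x + u) with h | h
      · exact absurd ((hconst u hu).trans hx1) h
      · exact zmod2_eq_one_of_ne_zero h
    have hconst₂ : ∀ u ∈ D, f₂ ζ (x + u) = f₂ ζ x := by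
      intro u hu
      rw [hf₂one u hu, ← hf₂one 0 D.zero_mem, add_zero]
    have hD₂ := const_iso D (f₂ ζ) (L₂ ζ) (c₂ ζ) (hf₂ ζ) x hconst₂
    have hT₂ : T₂ = ∅ := eq_empty_of_iso_top hS hΔ hT₂E hD₂
    rw [hT₂] at hj; exact absurd hj (notMem_empty j)

/-- **The isotropic case for `T₁ △ T₂`** (then `T₁ = T₂`): `|E| ≤ 2Δ²`, through the witness fibre of a common edge. -/
theorem bound_of_iso_symmDiff (hS : Simple E) (hΔ : EdgeMaxDegree Δ E) (hT₁E : T₁ ⊆ E) (hT₂E : T₂ ⊆ E)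
    (hf₁ : ∀ ζ x, f₁ ζ x = qform T₁ Prod.fst Prod.snd x + L₁ ζ x + c₁ ζ)
    (hf₂ : ∀ ζ x, f₂ ζ x = qform T₂ Prod.fst Prod.snd x + L₂ ζ x + c₂ ζ)
    (hunsat : ∀ ζ x, f₁ ζ x ≠ 0 ∨ f₂ ζ x ≠ 0)
    (hmin : ∀ j ∈ E, ∃ ζ x, (f₁ ζ x = 0 ↔ j ∉ T₁) ∧ (f₂ ζ x = 0 ↔ j ∉ T₂))
    (hiso₃ : ∀ u ∈ (⊤ : Submodule (ZMod 2) (Fin V → ZMod 2)), ∀ v ∈ (⊤ : Submodule (ZMod 2) (Fin V → ZMod 2)),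
      polar (T₁ ∆ T₂) Prod.fst Prod.snd u v = 0) :
    E.card ≤ 2 * Δ ^ 2 := by
  classical
  set D : Submodule (ZMod 2) (Fin V → ZMod 2) := ⊤ with hDdef
  have h𝒟 : ∀ x, x ∈ (univ : Finset (Fin V → ZMod 2)) ↔ x ∈ D := mem_univ_iff_top
  have hdim : finrank (ZMod 2) D = V := finrank_top_fun
  have hT₃E : T₁ ∆ T₂ ⊆ E := fun j hj => by
    rcases mem_symmDiff.1 hj with h | h
    exacts [hT₁E h.1, hT₂E h.1]
  have hT₃ : T₁ ∆ T₂ = ∅ := eq_empty_of_iso_top hS hΔ hT₃E hiso₃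
  have hT₁₂ : T₁ = T₂ := symmDiff_eq_bot.1 hT₃
  have hcov := mem_or_mem_fibres hunsat hmin
  have hET₁ : E ⊆ T₁ := fun j hj => by
    rcases hcov j hj with h | h
    · exact h
    · rw [hT₁₂]; exact h
  rcases T₁.eq_empty_or_nonempty with hT₁ | ⟨j, hj⟩
  · rw [hT₁] at hET₁; rw [subset_empty.1 hET₁, card_empty]; exact Nat.zero_le _
  -- the witness fibre of the common edge `j`: both forms are `≠ 0` there
  obtain ⟨ζ, x, h1, h2⟩ := hmin j (hT₁E hj)
  have hx1 : f₁ ζ x = 1 := zmod2_eq_one_of_ne_zero fun h => (h1.1 h) hj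
  have hx2 : f₂ ζ x = 1 := zmod2_eq_one_of_ne_zero fun h => (h2.1 h) (hT₁₂ ▸ hj)
  have hq₁ : ∀ x w, f₁ ζ (x + w) = f₁ ζ x + f₁ ζ w - f₁ ζ 0 + polar T₁ Prod.fst Prod.snd x w := by
    intro x w; simp only [hf₁]; exact quadratic_of_qform T₁ Prod.fst Prod.snd (L₁ ζ) (c₁ ζ) x w
  have hq₂ : ∀ x w, f₂ ζ (x + w) = f₂ ζ x + f₂ ζ w - f₂ ζ 0 + polar T₂ Prod.fst Prod.snd x w := by
    intro x w; simp only [hf₂]; exact quadratic_of_qform T₂ Prod.fst Prod.snd (L₂ ζ) (c₂ ζ) x w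
  obtain ⟨g₃, hg₃⟩ : ∃ g : (Fin V → ZMod 2) → ZMod 2, ∀ x, g x = f₁ ζ x + f₂ ζ x := ⟨_, fun _ => rfl⟩
  have hq₃ : ∀ x w, g₃ (x + w) = g₃ x + g₃ w - g₃ 0 + polar (T₁ ∆ T₂) Prod.fst Prod.snd x w := by
    intro x w; simp only [hg₃]; rw [polar_symmDiff, hq₁, hq₂]; ring
  rcases affine_dichotomy D univ h𝒟 g₃ hq₃ x hiso₃ with hε₃ | hconst
  · -- bias of `f₁ + f₂` vanishes on this fibre: two-term recount
    obtain ⟨n₁, hn₁d, hT₁c, hε₁, hiso₁⟩ := form_package Δ hS hΔ hT₁E D univ h𝒟 (f₁ ζ) hq₁ x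
    obtain ⟨n₂, hn₂d, hT₂c, hε₂, hiso₂⟩ := form_package Δ hS hΔ hT₂E D univ h𝒟 (f₂ ζ) hq₂ x
    rw [hdim] at hn₁d hn₂d hiso₁ hiso₂
    have hcard := card_le_abs_add univ (fun u => f₁ ζ (x + u)) (fun u => f₂ ζ (x + u)) fun u _ => hunsat ζ (x + u)
    simp only [← hg₃] at hcard
    rw [hε₃, abs_zero, add_zero, card_univ_fun] at hcard
    have hpow : 2 ^ V ≤ 2 ^ n₁ + 2 ^ n₂ := by
      have : (2 : ℤ) ^ V ≤ 2 ^ n₁ + 2 ^ n₂ := by linarith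
      exact_mod_cast this
    rcases pow_two_cases hn₁d hn₂d hpow with h | h | ⟨h, -⟩
    · have hT₁ : T₁ = ∅ := eq_empty_of_iso_top hS hΔ hT₁E (hiso₁ h)
      rw [hT₁] at hj; exact absurd hj (notMem_empty j)
    · have hT₂ : T₂ = ∅ := eq_empty_of_iso_top hS hΔ hT₂E (hiso₂ h)
      rw [← hT₁₂] at hT₂; rw [hT₂] at hj; exact absurd hj (notMem_empty j)
    · have h1 : V - n₁ ≤ 1 := by omega
      calc E.card ≤ T₁.card := card_le_card hET₁
        _ ≤ 2 * Δ ^ 2 * (V - n₁) := hT₁c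
        _ ≤ 2 * Δ ^ 2 * 1 := Nat.mul_le_mul_left _ h1
        _ = 2 * Δ ^ 2 := mul_one _
  · -- `f₁ + f₂` constant `= 0` on this fibre: `f₁ = f₂`, unsat forces `f₁ ≡ 1`, so `T₁` isotropic, empty
    have hγ : g₃ x = 0 := by rw [hg₃, hx1, hx2]; decide
    have hf₁one : ∀ u ∈ D, f₁ ζ (x + u) = 1 := by
      intro u hu
      have e : f₁ ζ (x + u) = f₂ ζ (x + u) := zmod2_eq_of_add_eq_zero (by rw [← hg₃, hconst u hu, hγ])
      rcases hunsat ζ (x + u) with h | h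
      · exact zmod2_eq_one_of_ne_zero h
      · rw [e]; exact zmod2_eq_one_of_ne_zero h
    have hconst₁ : ∀ u ∈ D, f₁ ζ (x + u) = f₁ ζ x := by
      intro u hu
      rw [hf₁one u hu, ← hf₁one 0 D.zero_mem, add_zero]
    have hD₁ := const_iso D (f₁ ζ) (L₁ ζ) (c₁ ζ) (hf₁ ζ) x hconst₁
    have hT₁ : T₁ = ∅ := eq_empty_of_iso_top hS hΔ hT₁E hD₁
    rw [hT₁] at hj; exact absurd hj (notMem_empty j)

/-- **Two quadratic forms over a family of fibres.**  If `f_i ζ = qform T_i + L_i ζ + c_i ζ` (`T_i ⊆ E`, `E` simple of maximum degree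
`Δ`) are never simultaneously `0` on any fibre `ζ`, and every edge of `E` has a flip witness on SOME fibre, then `|E| ≤ 6Δ²`. -/
theorem two_forms_fibres (hS : Simple E) (hΔ : EdgeMaxDegree Δ E) (hT₁E : T₁ ⊆ E) (hT₂E : T₂ ⊆ E)
    (hf₁ : ∀ ζ x, f₁ ζ x = qform T₁ Prod.fst Prod.snd x + L₁ ζ x + c₁ ζ)
    (hf₂ : ∀ ζ x, f₂ ζ x = qform T₂ Prod.fst Prod.snd x + L₂ ζ x + c₂ ζ)
    (hunsat : ∀ ζ x, f₁ ζ x ≠ 0 ∨ f₂ ζ x ≠ 0)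
    (hmin : ∀ j ∈ E, ∃ ζ x, (f₁ ζ x = 0 ↔ j ∉ T₁) ∧ (f₂ ζ x = 0 ↔ j ∉ T₂)) :
    E.card ≤ 6 * Δ ^ 2 := by
  classical
  rcases E.eq_empty_or_nonempty with hE | ⟨j₀, hj₀⟩
  · rw [hE, card_empty]; exact Nat.zero_le _
  -- any fibre will do for the three packages
  obtain ⟨ζ, x, -, -⟩ := hmin j₀ hj₀
  set D : Submodule (ZMod 2) (Fin V → ZMod 2) := ⊤ with hDdef
  have h𝒟 : ∀ x, x ∈ (univ : Finset (Fin V → ZMod 2)) ↔ x ∈ D := mem_univ_iff_top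
  have hdim : finrank (ZMod 2) D = V := finrank_top_fun
  have hq₁ : ∀ x w, f₁ ζ (x + w) = f₁ ζ x + f₁ ζ w - f₁ ζ 0 + polar T₁ Prod.fst Prod.snd x w := by
    intro x w; simp only [hf₁]; exact quadratic_of_qform T₁ Prod.fst Prod.snd (L₁ ζ) (c₁ ζ) x w
  have hq₂ : ∀ x w, f₂ ζ (x + w) = f₂ ζ x + f₂ ζ w - f₂ ζ 0 + polar T₂ Prod.fst Prod.snd x w := by
    intro x w; simp only [hf₂]; exact quadratic_of_qform T₂ Prod.fst Prod.snd (L₂ ζ) (c₂ ζ) x w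
  obtain ⟨g₃, hg₃⟩ : ∃ g : (Fin V → ZMod 2) → ZMod 2, ∀ x, g x = f₁ ζ x + f₂ ζ x := ⟨_, fun _ => rfl⟩
  have hq₃ : ∀ x w, g₃ (x + w) = g₃ x + g₃ w - g₃ 0 + polar (T₁ ∆ T₂) Prod.fst Prod.snd x w := by
    intro x w; simp only [hg₃]; rw [polar_symmDiff, hq₁, hq₂]; ring
  have hT₃E : T₁ ∆ T₂ ⊆ E := fun j hj => by
    rcases mem_symmDiff.1 hj with h | h
    exacts [hT₁E h.1, hT₂E h.1]
  have hcov := mem_or_mem_fibres hunsat hmin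
  obtain ⟨n₁, hn₁d, hT₁c, hε₁, hiso₁⟩ := form_package Δ hS hΔ hT₁E D univ h𝒟 (f₁ ζ) hq₁ x
  obtain ⟨n₂, hn₂d, hT₂c, hε₂, hiso₂⟩ := form_package Δ hS hΔ hT₂E D univ h𝒟 (f₂ ζ) hq₂ x
  obtain ⟨n₃, hn₃d, hT₃c, hε₃, hiso₃⟩ := form_package Δ hS hΔ hT₃E D univ h𝒟 g₃ hq₃ x
  rw [hdim] at hn₁d hn₂d hn₃d hiso₁ hiso₂ hiso₃
  have hcard := card_le_abs_add univ (fun u => f₁ ζ (x + u)) (fun u => f₂ ζ (x + u)) fun u _ => hunsat ζ (x + u)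
  simp only [← hg₃] at hcard
  rw [card_univ_fun] at hcard
  have hpow : 2 ^ V ≤ 2 ^ n₁ + 2 ^ n₂ + 2 ^ n₃ := by
    have : (2 : ℤ) ^ V ≤ 2 ^ n₁ + 2 ^ n₂ + 2 ^ n₃ := by linarith
    exact_mod_cast this
  -- coverings by pairs of forms
  have hE12 : E.card ≤ T₁.card + T₂.card :=
    (card_le_card fun j hj => mem_union.2 (hcov j hj)).trans (card_union_le _ _)
  have hE13 : E.card ≤ T₁.card + (T₁ ∆ T₂).card := by
    refine (card_le_card fun j hj => mem_union.2 ?_).trans (card_union_le _ _)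
    by_cases h1 : j ∈ T₁
    · exact Or.inl h1
    · exact Or.inr (mem_symmDiff.2 (Or.inr ⟨(hcov j hj).resolve_left h1, h1⟩))
  have hE23 : E.card ≤ T₂.card + (T₁ ∆ T₂).card := by
    refine (card_le_card fun j hj => mem_union.2 ?_).trans (card_union_le _ _)
    by_cases h2 : j ∈ T₂
    · exact Or.inl h2
    · exact Or.inr (mem_symmDiff.2 (Or.inl ⟨(hcov j hj).resolve_right h2, h2⟩))
  have h26 : 2 * Δ ^ 2 ≤ 6 * Δ ^ 2 := Nat.mul_le_mul_right _ (by norm_num)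
  rcases pow_three_cases hn₁d hn₂d hn₃d hpow with h | h | h | h | h | h
  · exact (bound_of_iso_fst hS hΔ hT₁E hT₂E hf₁ hf₂ hunsat hmin (hiso₁ h)).trans h26
  · -- swap the roles of the two forms
    have h' := bound_of_iso_fst (T₁ := T₂) (T₂ := T₁) (f₁ := f₂) (f₂ := f₁) hS hΔ hT₂E hT₁E hf₂ hf₁
      (fun ζ x => (hunsat ζ x).symm) (fun j hj => by
        obtain ⟨ζ, x, h1, h2⟩ := hmin j hj
        exact ⟨ζ, x, h2, h1⟩) (hiso₂ h)
    exact h'.trans h26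
  · exact (bound_of_iso_symmDiff hS hΔ hT₁E hT₂E hf₁ hf₂ hunsat hmin (hiso₃ h)).trans h26
  · have : T₁.card + T₂.card ≤ 2 * Δ ^ 2 * ((V - n₁) + (V - n₂)) := by
      rw [mul_add]; exact add_le_add hT₁c hT₂c
    exact hE12.trans (this.trans (by nlinarith [Nat.zero_le (Δ ^ 2), show (V - n₁) + (V - n₂) ≤ 3 by omega]))
  · have : T₁.card + (T₁ ∆ T₂).card ≤ 2 * Δ ^ 2 * ((V - n₁) + (V - n₃)) := by
      rw [mul_add]; exact add_le_add hT₁c hT₃c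
    exact hE13.trans (this.trans (by nlinarith [Nat.zero_le (Δ ^ 2), show (V - n₁) + (V - n₃) ≤ 3 by omega]))
  · have : T₂.card + (T₁ ∆ T₂).card ≤ 2 * Δ ^ 2 * ((V - n₂) + (V - n₃)) := by
      rw [mul_add]; exact add_le_add hT₂c hT₃c
    exact hE23.trans (this.trans (by nlinarith [Nat.zero_le (Δ ^ 2), show (V - n₂) + (V - n₃) ≤ 3 by omega]))

end Fibres

end Summit.PneNP.PneNP.Theorems.PstarFreeFoldedForms
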